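import Literature.MathematicalPhysics.QuantumFieldTheory.Balaban1983to89.B3Ineq25Op116RegularTorus
import Literature.MathematicalPhysics.QuantumFieldTheory.Balaban1983to89.B3Op116DKernelRegularCellBox
import Literature.MathematicalPhysics.QuantumFieldTheory.Balaban1983to89.B3Op116HolderKernelRegularBox
import Literature.MathematicalPhysics.QuantumFieldTheory.Balaban1983to89.B3Op116MixedKernelRegularCellBox
import Literature.MathematicalPhysics.QuantumFieldTheory.Balaban1983to89.B3Op116CollarHolderBinder
import Literature.MathematicalPhysics.QuantumFieldTheory.Balaban1983to89.B3Op116KernelCurrencyBox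
import Literature.MathematicalPhysics.QuantumFieldTheory.Balaban1983to89.B3Op116MixedCurrency

/-!
# Bałaban, *(Higgs)₂,₃ quantum fields in a finite volume III. Renormalization* [B3] — inequality (2.5) p. 424, THE (1.16) ALTERNATIVE
`‖h(1.16)_{n,n′}h′‖_{1,α} ≤ O((e(L^kε)p(L^kε))^{n+n′})e^{−δ₀dist(supp h,supp h′)}` ON A CELL-PRODUCT BOX `□` WITHOUT THE SUPPORT CLAUSE ON THE
PERTURBATION `Ã` — the ROW-LEVEL assembly of the cell's route γ′ (GAPS G-B3-16.A1): `ineq25At_op116_cellBox`, and its form with an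
`ε`-free, `k`-free constant `ineq25At_op116_cellBox_uniform`

statement-level skeleton of published theorems with citation tags; proofs where landed; nothing here is a claim about the Yang–Mills mass gap

T. Bałaban, Commun. Math. Phys. **88** (1983) 411–445 [cite: Balaban1983Higgs3]; part I, Commun. Math. Phys. **85** (1982) 603–636
[cite: Balaban1982Higgs1].  PDFs held: `paper:balaban1983-higgs-2-3-quantum-fields-finite-volume` (journal page = PDF page + 410; p. 412 =
`p0002.txt`, p. 414 = `p0004.txt`, p. 420 = `p0010.txt`, p. 424 = `p0014.txt`, p. 426 = `p0016.txt`, p. 433 = `p0023.txt`),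
`paper:balaban1982-cmp85-higgs23-i` (p. 610 = Prop. 2.1, p. 611 l.1–2).

CITATION HEADER (lean-in-tree rule).  Cell `lit-balaban` (HOME `run/shared/lean/pub/lit-balaban/`), Phase-2 proof seat **p35** gen 30
(unit `lit-balaban-p35`); free-target protocol G.5-34(d), TAKING line HOME/STATUS.md 2026-08-25T17:23:30Z (cc r15 = fold owner of rows
B3.Eq2.5 ∕ B3.Eq1.16 ∕ B3.Txt@433 ∕ B3.Prop1, p40, p33).  HOME/GAPS.md G-B3-16.A1 OWNER NOTE 5 (r15 g21, 2026-08-25T04:16:52Z): «the eight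
binders hV hV′ hDv hDv′ hH hH′ hM hM′ of p40's `B3Ineq25Op116Smooth.ineq25At_op116_smooth_of_bounds` on Ω = □ = cellBox k K₀ S WITHOUT the
support clause on Ã … the one-screen instantiation of `ineq25At_op116_smooth_of_bounds` on □ with these eight binders is p35's OPTIONAL sequel
(stem free)» — THIS FILE is that sequel; a LOCATED MEMBER of rows B3.Eq2.5 ∕ B3.Eq1.16 (cells only, zero head weight: both heads are `proved`
by route δ and the torus∕region members).  USED BY NAME, never restated: p40 g72's assembly `B3Ineq25Op116Smooth.ineq25At_op116_smooth_of_bounds`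
and its carrier `sect2Smooth116`; p40 g74's `B3Ineq25Op116RegularTorus.{entry_mono, entry_mono_holder}`; route γ′'s (C)-plugs on `□` —
p35 g27's D `B3Op116DKernelRegularCellBox.{kernel116_value_cellBox_le, kernel116_deriv_cellBox_interior_le}` (p381539), E
`B3Op116HolderKernelRegularBox.kernel116_holder_cellBox_interior_le` (p381545), p35 g28's M3
`B3Op116MixedKernelRegularCellBox.kernel116_mixed_cellBox_interior_le` (p391897); p40 g77's contour geometry
`B3Op116CollarHolderBinder.{mem_of_isAdm_near, holder_far_of_deriv_row}`; p33 g61's `B3Ineq25SmoothLocalization.ineq25_smooth_regularNested`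
(the `δG_k(Ω,Ω₂,B̃)` clause); the typer's `B1Ineq225RegularBox.{cellBox, isBigBlockUnion_cellBox}`; r14's `B3Ineq210RegularRegion.Interior`;
for §3, p35 g29's currency lemmas `B3Op116KernelCurrencyBox.{valCB_currency, derCBθ_currency, holCBθ_currency}` (C2, p393531) and
`B3Op116MixedCurrency.{mixCB_currency, seqMU_rate}` (C3, p394384), p40's `B3Ineq25Op116Smooth.ineq25At_smooth116_mono`.
TEMPLATE: p40 g75's region assembly `B3Ineq25Op116RegularRegion.ineq25At_op116_region` (R5), whose hypothesis «Ã supported on deep bonds»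
(`hAS`, print p. 412) is exactly what this file REMOVES on a box.

## What is printed (verbatim)

(1.16) p. 414 [PDF 4]: *"in the last term of this expansion, equal to [G_k(Ω,B̃)V_k(Ã,B̃)]^n G_k(Ω,Ã+B̃)[V_k(Ã,B̃)G_k(Ω,B̃)]^{n′}, (1.16) we
have the propagator G_k(Ω,Ã+B̃). … for n, n′ sufficiently large, a kernel of the operator (1.16) is a sufficiently regular function of both
variables. More exactly the Hölder norms of the covariant derivatives of this kernel, the norms defined for example in the inequalities
(I.2.24) and (I.2.25) of Proposition I.2.1, are exponentially decaying with the distance of the arguments and are uniformly bounded by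
O(1)(e(L^kε)^{1−α})^{n+n′}, where α > 0 but can be arbitrarily small. This estimate follows easily from the properties of the propagators
G_k(Ω,A) proved in the next paper."*;  (2.5) p. 424 [PDF 14]: *"In the estimates we treat them as external fields and we use the
inequalities: ‖h(an operator δG_k(Ω,Ω₂,B̃) or (1.16))h′‖_{1,α} ≤ O(e^{−δ₀dist(Ω₂,∂Ω)} or (e(L^kε)p(L^kε))^{n+n′})e^{−δ₀dist(supp h, supp h′)},
(2.5) where h, h′ are functions giving the localizations of the vertices."*;  Prop. 1 pp. 420–421 [PDF 10–11]: *"The constant O(1) … is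
independent of ε, k, the domains Ω, Ω₁, Ω₂, the vector field B̃ (if they satisfy the conditions mentioned previously)."*;  p. 433 [PDF 23]:
*"We take a cube □₁ of size r(L^kε) containing the above cube in the center, and next we take a cube □ of size 3r(L^kε) and with □₁ in the
center. We assume that □₁, □ are sums of big blocks of the unit lattice."*;  [B1] p. 611 l.1–2 [cite: Balaban1982Higgs1]: *"For some simple
sets Ω, e.g. for rectangular parallelepipeds, the inequalities hold without any restrictions on the points x, x′, i.e. for all x, x′ ∈ Ω."*

## What this file proves, and how

§1 **`holder_binder_of_inside`** — THE HÖLDER BINDER OVER ALL ADMISSIBLE CONTOURS FROM THE BINDER OVER CONTOURS INSIDE `Ω` AND THE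
ROW-DERIVATIVE BINDER (any operator `T`, any region `Ω`, cube size `K₀ ≥ 1`): p40's binder `hH` of `ineq25At_op116_smooth_of_bounds` asks the
transported Hölder difference along EVERY admissible contour `Γ_{x₁,x₂}` (`|Γ| ≤ d|x₁ − x₂|`, [B1] p. 610) between `Interior` anchors, while
route γ′'s plug E reads `U(B̃(Γ))` inside the box only (the two-anchor (2.11) dictionary `hcolB_le` transports inside `□`; DESIGN-FILE4
§20(b)).  The gap is closed by p40 g77's near∕far split, BY NAME: far pairs `L^kε ≤ ε|x₁ − x₂|` — `‖U(Γ)v − u‖ ≤ ‖v‖ + ‖u‖` and the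
row-derivative binder (`holder_far_of_deriv_row`, constant `2C_D`); near pairs `ε|x₁ − x₂| < L^kε` — every admissible `Γ` stays within
`d·L^k` of `x₁`, inside the `Interior` radius (`mem_of_isAdm_near`), so the inside binder applies.  Constant `C_H + 2C_D`.
§2 **`ineq25At_op116_cellBox`** — INEQUALITY (2.5), THE (1.16) ALTERNATIVE, ON A CELL-PRODUCT BOX `□ = cellBox k K₀ S` WITHOUT THE SUPPORT
CLAUSE ON `Ã`, for all orders `n, n′ ≥ 1` with `n + n′ > d`, every `0 ≤ α < 1`, every big-block union `Ω₂ ⊆ □`: the region theorem R5(C)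
`ineq25At_op116_region` with `Ω := □` and its hypothesis `hAS` («Ã_b ≠ 0 ⇒ DeepBlk b₋ ∧ DeepBlk b₊») DROPPED — `Ã` small and (I.2.23)-regular
on the lattice, `B̃`, `Ã+B̃` (I.2.23)-regular on `□` up to `∂□` and small, nothing else.  Proof = p40's `ineq25At_op116_smooth_of_bounds` on
`Ω = □` with hV∕hV′ ← D's `kernel116_value_cellBox_le` (all `x`, `x′ ∈ □`), hDv∕hDv′ ← D's `kernel116_deriv_cellBox_interior_le`, hH∕hH′ ← §1
on E's `kernel116_holder_cellBox_interior_le` at orders `(n−1)+1, n′` ∕ `(n′−1)+1, n` and D's derivative binder, hM∕hM′ ← M3's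
`kernel116_mixed_cellBox_interior_le`, the `δG_k(□,Ω₂,B̃)` clause ← p33's `ineq25_smooth_regularNested` (`□` is a big-block union,
`isBigBlockUnion_cellBox`); scale factors `(L^kε)^{n+n′} ≤ (e_Rp_R)^{n+n′}` and the four plug rates weakened to their minimum by
`entry_mono`∕`entry_mono_holder`.  CONSTANT (displayed): `C_G + K(c₁,c₂+2c₁,d,m)·(valCB(M) + derCBθ(M)) + (holCBθ(M−1) + 2derCBθ(M) +
d·m·mixCB(M)·#Ix)`, `M = n + n′`, each γ′ constant at ITS OWN plug dictionary `(δ_V,C_V)`, `(δ_D,C_D)`, `(δ_H,C_H)`, `(δ_M,C_M,C_MM)` (as R5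
carries `(δ, C₁, …, C₄)`); RATE: `min δ₀ (min (min (δ_V∕(4L)^M) (δ_D∕(4L)^M∕2)) (min (δ_H∕(4L)^M) (rateM(M−1)∕2)))` (`rateB_closed`).
§3 **`ineq25At_op116_cellBox_uniform`** — THE SAME WITH A CONSTANT AND A RATE TAKING NO LATTICE ARGUMENT (Prop. 1 pp. 420–421 «independent
of ε, k, the domains …»): §2 with the additional regime hypothesis `L^k·δ_A·|e| ≤ t` on `Ã` and the conclusion at rate
`min δ₀ (unifRB d L N n_F …)` with constant `unifCB d L N n_F m c₁ c₂ C_V C_D C_H C_M C_MM C_G δ_V δ_D δ_H δ_M a α (|e|s) t n n′` (two `def`s with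
bodies: the §2 display with each γ′ constant replaced by p35 g29's ε-free, k-free twin `valCBU` ∕ `derCBθU` ∕ `holCBθU` ∕ `mixCBU` and the mixed
rate by `(seqMU₁ …).1`) — by `valCB_currency` ∕ `derCBθ_currency` ∕ `holCBθ_currency` (C2), `mixCB_currency` ∕ `seqMU_rate` (C3) and p40's
`ineq25At_smooth116_mono`; the only lattice data left are the face count `n_F = #faces(□)` and print's `σ = |e|s` (the □ twin of p35 g29's
region theorem `B3Ineq25Op116UniformCurrency.ineq25At_op116_region_uniform`).

## Honest scope / declared divergences (F7)

(i) `□ = cellBox k K₀ S`: ANY product of finite sets of large-block (cell) indices (print's `□` is a cube of size `3r(L^kε)`), `K₀ ≥ K₀min`,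
`K₀ ∣ M`, `≥ 3` cubes per direction; the (1.16) clause is obtained at `Interior k K₀ □` points (print's `□₁` in the center of `□`, p. 433) — all the
carrier's smooth localization class asks.  NO support clause and NO deep-bond clause on `Ã`: this is print's ONE-PIECE expansion of
`G_k(□,B̃₀+B̃′)` in all of `B̃′` on `□` (G-B3-16.A1, route γ′ = the literal route; the rows' heads are carried by route δ).  (ii) `(e_Rp_R)^{n+n′}` is read as any `e_Rp_R ≥ L^kε`; the coupling powers live in
the explicit constants, NOT simplified to print's `O(1)(e(L^kε)p(L^kε))^{n+n′}`; their uniformity in `ε`, `k` GIVEN print's smallness parameters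
`|e|s`, `L^k|e|δ_A` (and `n_F(□)`, `θ = 1`) is p35 g29's currency programme `B3Op116KernelCurrencyBox` ∕ `B3Op116MixedCurrency` (not restated
here); the p. 433 l.13–14 bookkeeping `σ, τ, n_F ↦ e(L^kε), p(L^kε), r(L^kε)` and the δ₀(d)-first rate order are NOT typed.  (iii) `α < 1`
strictly, `n, n′ ≥ 1` (the `n = 0` corner of E, `kernel116_holder_cellBox_zero_left_interior_le`, is not needed at these orders).  (iv) The four
plugs keep their own dictionaries (four `(δ_i, C_i)`), the smallness threshold `t` and the cube size are common; the regime is the conjunction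
of the plugs' regimes and p33's (`L^kδ_B ≤ c|e|`, charge `e² ≤ E₀`).  (v) Rates not optimized.  (vi) §3's `unifCB` ∕ `unifRB` still take the
face count `n_F(□)` and `σ = |e|s`, `τ = t` (print: `σ ≤ e(L^kε)p(L^kε)`, p. 412; `n_F ↦ r(L^kε)`, p. 433 — not typed).  Two `def`s with bodies
(`unifCB`, `unifRB`: explicit real constants), no `def … : Prop`, no new named fact, no `sorry`; axioms standard.  Value = the assembled located
estimate (2.5), (1.16)-alternative, of B3 §2 on print's boxes by print's own route — NOT summit progress and nothing about the Yang–Mills mass gap.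
-/

noncomputable section

open scoped BigOperators

namespace Literature.MathematicalPhysics.QuantumFieldTheory.Balaban1983to89.B3Ineq25Op116CellBox

open HiggsLattice (ChargeData ScalarField covDeriv)
open HiggsCovariance (propagatorK E)
open B1Eq230FluctCov (Ix cb)
open B1TorusChainTransport (hol)
open B1TorusCubeCover (half)
open B1TorusRegionHSizes (IsBigBlockUnion)
open B1Ineq225RegularBox (cellBox isBigBlockUnion_cellBox)
open B3Ineq210RegularTorus (mesh_eq_pow_mul)
open B3Ineq210RegularRegion (Interior)
open B3Ineq211RegularTorus (IsAdm)
open B3Ineq25SmoothLocalization (sect2DeltaSmooth ineq25_smooth_regularNested)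
open B3Ineq31SmoothLocalization (smoothConst)
open B3Ineq25Op116Smooth (sect2Smooth116 ineq25At_op116_smooth_of_bounds ineq25At_smooth116_mono)
open B3Ineq25Op116RegularTorus (entry_mono entry_mono_holder)
open B3Op116DKernelRegularTorus (cK1)
open B3Op116DKernelRegularBox (valCB rateB rateB_closed)
open B3Op116DKernelRegularCellBox (derCBθ kernel116_value_cellBox_le kernel116_deriv_cellBox_interior_le)
open B3Op116HolderKernelRegularBox (holCBθ kernel116_holder_cellBox_interior_le)
open B3Op116MixedKernelRegularBox (mixCB rateM seqM_pos)
open B3Op116MixedKernelRegularCellBox (kernel116_mixed_cellBox_interior_le)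
open B3Op116CollarBoxFaces (faces)
open B3Op116CollarHolderBinder (mem_of_isAdm_near holder_far_of_deriv_row)
open B3Ineq210MixedRegularTorus (dip onb)
open B3Eq116TwoSidedExpansion (op116)

variable {P : HiggsLattice.Params} {N : ℕ}

/-! ## §1 The Hölder binder over all admissible contours from the binder inside `Ω` and the row-derivative binder -/

section HolderBridge

variable (C : ChargeData N) (B : HiggsLattice.VecField P 0) {k K₀ : ℕ} {Ω : Finset (HiggsLattice.Site P 0)}

/-- **THE HÖLDER BINDER `hH` OVER ALL ADMISSIBLE CONTOURS, FROM THE BINDER ALONG CONTOURS INSIDE `Ω` AND THE ROW-DERIVATIVE BINDER `hDv`.**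
For any operator `T`, any `k`-scale region `Ω` with cube parameter `K₀ ≥ 1`, `α ≥ 0`, `δ ≥ 0`, `C_D·t, C_H·t ≥ 0`: if the row derivative
`ε^{−d}Σ_{i′}‖(D^ε_B T e_{(x′,i′)})(⟨x,μ⟩)‖ ≤ C_D·t·((L^kε)((L^kε)^d)^{−1})e^{−δ|x−x′|/L^k}` at `Interior` points and the transported difference
`ε^{−d}Σ_{i′}‖U(B(Γ))(D^ε_B T e_{(x′,i′)})(⟨x₂,μ⟩) − (D^ε_B T e_{(x′,i′)})(⟨x₁,μ⟩)‖ ≤ (ε|x₁−x₂|)^α·C_H·t·((L^kε)((L^kε)^d)^{−1}((L^kε)^α)^{−1})·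
e^{−δmin(|x₁−x′|,|x₂−x′|)/L^k}` holds at `Interior` anchors for the admissible contours `Γ ⊂ Ω`, then the latter holds for ALL admissible contours
with `C_H + 2C_D`: far pairs (`L^kε ≤ ε|x₁−x₂|`) by `‖U(Γ)v − u‖ ≤ ‖v‖ + ‖u‖` (p40 g77 `holder_far_of_deriv_row`), near pairs because an
admissible contour (`|Γ| ≤ d|x₁−x₂| < dL^k`) from an interior point stays in `Ω` (`mem_of_isAdm_near`).
[cite: Balaban1983Higgs3, (2.5) p.424, (1.32) p.420, (2.11) p.426, p.433] [cite: Balaban1982Higgs1, Prop. 2.1 (2.24) p.610] -/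
theorem holder_binder_of_inside (hK₀ : 1 ≤ K₀) (T : Module.End ℝ (ScalarField P 0 N)) {CD CH t δ α : ℝ}
    (hCDt : 0 ≤ CD * t) (hCHt : 0 ≤ CH * t) (hδ : 0 ≤ δ) (hα : 0 ≤ α)
    (hDv : ∀ (μ : Fin P.d) (x x' : HiggsLattice.Site P 0), Interior k K₀ Ω x → Interior k K₀ Ω x' →
      (P.mesh 0 ^ P.d)⁻¹ * ∑ i' : Ix N, ‖covDeriv C B (T (cb P N 0 (x', i'))) ⟨x, μ⟩‖
        ≤ CD * t * (P.mesh k * (P.mesh k ^ P.d)⁻¹) * Real.exp (-(δ * ((HiggsLattice.Site.tdist x x' : ℝ) / (P.L : ℝ) ^ k))))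
    (hHin : ∀ (μ : Fin P.d) (x₁ x₂ x' : HiggsLattice.Site P 0) (Γ : List (HiggsLattice.Site P 0)),
      Interior k K₀ Ω x₁ → Interior k K₀ Ω x₂ → Interior k K₀ Ω x' → x₁ ≠ x₂ → IsAdm x₁ x₂ Γ → (∀ z ∈ Γ, z ∈ Ω) →
      (P.mesh 0 ^ P.d)⁻¹ * ∑ i' : Ix N, ‖hol C B x₁ Γ (covDeriv C B (T (cb P N 0 (x', i'))) ⟨x₂, μ⟩)
          - covDeriv C B (T (cb P N 0 (x', i'))) ⟨x₁, μ⟩‖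
        ≤ (P.mesh 0 * (HiggsLattice.Site.tdist x₁ x₂ : ℝ)) ^ α *
          (CH * t * (P.mesh k * (P.mesh k ^ P.d)⁻¹ * (P.mesh k ^ α)⁻¹)) *
          Real.exp (-(δ * (min (HiggsLattice.Site.tdist x₁ x' : ℝ) (HiggsLattice.Site.tdist x₂ x' : ℝ) / (P.L : ℝ) ^ k))))
    (μ : Fin P.d) (x₁ x₂ x' : HiggsLattice.Site P 0) (Γ : List (HiggsLattice.Site P 0))
    (hx₁ : Interior k K₀ Ω x₁) (hx₂ : Interior k K₀ Ω x₂) (hx' : Interior k K₀ Ω x') (hne : x₁ ≠ x₂) (hΓ : IsAdm x₁ x₂ Γ) :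
    (P.mesh 0 ^ P.d)⁻¹ * ∑ i' : Ix N, ‖hol C B x₁ Γ (covDeriv C B (T (cb P N 0 (x', i'))) ⟨x₂, μ⟩)
        - covDeriv C B (T (cb P N 0 (x', i'))) ⟨x₁, μ⟩‖
      ≤ (P.mesh 0 * (HiggsLattice.Site.tdist x₁ x₂ : ℝ)) ^ α *
          ((CH + 2 * CD) * t * (P.mesh k * (P.mesh k ^ P.d)⁻¹ * (P.mesh k ^ α)⁻¹)) *
          Real.exp (-(δ * (min (HiggsLattice.Site.tdist x₁ x' : ℝ) (HiggsLattice.Site.tdist x₂ x' : ℝ) / (P.L : ℝ) ^ k))) := by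
  have hq : 0 ≤ (P.mesh 0 * (HiggsLattice.Site.tdist x₁ x₂ : ℝ)) ^ α :=
    Real.rpow_nonneg (mul_nonneg (P.mesh_pos 0).le (Nat.cast_nonneg _)) α
  have hSx : 0 ≤ P.mesh k * (P.mesh k ^ P.d)⁻¹ * (P.mesh k ^ α)⁻¹ := by
    have := Real.rpow_pos_of_pos (P.mesh_pos k) α
    have := P.mesh_pos k
    positivity
  have hE := Real.exp_nonneg
    (-(δ * (min (HiggsLattice.Site.tdist x₁ x' : ℝ) (HiggsLattice.Site.tdist x₂ x' : ℝ) / (P.L : ℝ) ^ k)))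
  -- lifting a binder constant `c·t ≤ (C_H + 2C_D)·t`
  have lift : ∀ {c : ℝ}, c * t ≤ (CH + 2 * CD) * t →
      (P.mesh 0 * (HiggsLattice.Site.tdist x₁ x₂ : ℝ)) ^ α * (c * t * (P.mesh k * (P.mesh k ^ P.d)⁻¹ * (P.mesh k ^ α)⁻¹)) *
          Real.exp (-(δ * (min (HiggsLattice.Site.tdist x₁ x' : ℝ) (HiggsLattice.Site.tdist x₂ x' : ℝ) / (P.L : ℝ) ^ k)))
        ≤ (P.mesh 0 * (HiggsLattice.Site.tdist x₁ x₂ : ℝ)) ^ α *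
          ((CH + 2 * CD) * t * (P.mesh k * (P.mesh k ^ P.d)⁻¹ * (P.mesh k ^ α)⁻¹)) *
          Real.exp (-(δ * (min (HiggsLattice.Site.tdist x₁ x' : ℝ) (HiggsLattice.Site.tdist x₂ x' : ℝ) / (P.L : ℝ) ^ k))) :=
    fun hc => mul_le_mul_of_nonneg_right (mul_le_mul_of_nonneg_left (mul_le_mul_of_nonneg_right hc hSx) hq) hE
  by_cases hfar : P.mesh k ≤ P.mesh 0 * (HiggsLattice.Site.tdist x₁ x₂ : ℝ)
  · -- far pairs: two derivative rows
    have h := holder_far_of_deriv_row C B T (Interior k K₀ Ω) hCDt hδ hα hDv μ x₁ x₂ x' Γ hx₁ hx₂ hx' hfar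
    exact h.trans (lift (by nlinarith))
  · -- near pairs: the contour stays inside `Ω`
    have hnear : (HiggsLattice.Site.tdist x₁ x₂ : ℝ) ≤ (P.L : ℝ) ^ k := by
      rw [not_le, mesh_eq_pow_mul P k] at hfar
      have hε := P.mesh_pos 0
      by_contra hc
      rw [not_le] at hc
      nlinarith
    have hΓΩ : ∀ z ∈ Γ, z ∈ Ω := mem_of_isAdm_near hK₀ hx₁ hnear hΓ
    exact (hHin μ x₁ x₂ x' Γ hx₁ hx₂ hx' hne hΓ hΓΩ).trans (lift (by nlinarith))

end HolderBridge

/-! ## §2 (2.5), the (1.16) alternative, on a cell-product box without the support clause -/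

section CellBox

/-- `L^{r} − 1 > 0` for a real exponent `r > 0` (`L > 1`). [cite: Balaban1983Higgs3, (2.10) p.426] -/
private theorem rpow_sub_one_pos (hL : 1 < P.L) {r : ℝ} (hr : 0 < r) : 0 < (P.L : ℝ) ^ r - 1 := by
  have hL1 : (1 : ℝ) < (P.L : ℝ) := by exact_mod_cast hL
  have := Real.one_lt_rpow hL1 hr
  linarith

/-- `valCB(M) ≥ 0` for `M + 2 > d` (seeds `ε^dC`, `c_{K1}`; `C, s, δ_A ≥ 0`, `0 < δ₁`). [cite: Balaban1983Higgs3, (1.16) p.414, (2.10) p.426] -/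
theorem valCB_nonneg (hL : 1 < P.L) {C : ChargeData N} (k nF : ℕ) {a Cst s δA δ₁ : ℝ} (hδ₁ : 0 < δ₁) (hCst : 0 ≤ Cst)
    (hs : 0 ≤ s) (hδA : 0 ≤ δA) (M : ℕ) (hd : (P.d : ℝ) < (M : ℝ) + 2) :
    0 ≤ valCB P N C k nF a (P.mesh 0 ^ P.d * Cst) (cK1 P C k Cst s) s δA δ₁ M := by
  have hc : 0 ≤ P.mesh 0 ^ P.d * Cst := mul_nonneg (pow_nonneg (P.mesh_pos 0).le _) hCst
  have hcK1 : 0 ≤ cK1 P C k Cst s := (B3Op116DKernelRegularTorus.cK1_ge (P := P) (C := C) (k := k) hCst hs).2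
  obtain ⟨-, -, hcv, -, -⟩ := B3Op116DKernelRegularBox.seqB_pos (P := P) (N := N) (C := C) (k := k) (nF := nF) (a := a)
    (cK2 := P.mesh 0 ^ P.d * Cst) (cK1 := cK1 P C k Cst s) (s := s) (δA := δA) (δ₀ := δ₁) (cv₀ := P.mesh 0 ^ P.d * Cst)
    (cd₀ := cK1 P C k Cst s) hL hδ₁ le_rfl hc hcK1 hc hcK1 hs hδA M
  have hden : 0 < (P.L : ℝ) ^ ((2 : ℝ) + (M : ℝ) - (P.d : ℝ)) - 1 := rpow_sub_one_pos hL (by linarith)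
  unfold valCB
  have := P.mesh_pos 0
  positivity

/-- `derCBθ(M) ≥ 0` for `M + 1 > d`, `M ≥ 1`, `θ > 0`. [cite: Balaban1983Higgs3, (1.16) p.414, (2.10) p.426, p.433] -/
theorem derCBθ_nonneg (hL : 1 < P.L) {C : ChargeData N} (k nF : ℕ) {a Cst s δA δ₁ θ : ℝ} (hδ₁ : 0 < δ₁) (hCst : 0 ≤ Cst)
    (hs : 0 ≤ s) (hδA : 0 ≤ δA) (hθ : 0 < θ) (M : ℕ) (hM : 1 ≤ M) (hd : (P.d : ℝ) < (M : ℝ) + 1) :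
    0 ≤ derCBθ P N C k nF a (P.mesh 0 ^ P.d * Cst) (cK1 P C k Cst s) s δA δ₁ θ M := by
  have hc : 0 ≤ P.mesh 0 ^ P.d * Cst := mul_nonneg (pow_nonneg (P.mesh_pos 0).le _) hCst
  have hcK1 : 0 ≤ cK1 P C k Cst s := (B3Op116DKernelRegularTorus.cK1_ge (P := P) (C := C) (k := k) hCst hs).2
  obtain ⟨hr0, -, -, hcd, hcS⟩ := B3Op116DKernelRegularBox.seqB_pos (P := P) (N := N) (C := C) (k := k) (nF := nF) (a := a)
    (cK2 := P.mesh 0 ^ P.d * Cst) (cK1 := cK1 P C k Cst s) (s := s) (δA := δA) (δ₀ := δ₁) (cv₀ := P.mesh 0 ^ P.d * Cst)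
    (cd₀ := cK1 P C k Cst s) hL hδ₁ le_rfl hc hcK1 hc hcK1 hs hδA M
  have hden : 0 < (P.L : ℝ) ^ ((1 : ℝ) + (M : ℝ) - (P.d : ℝ)) - 1 := rpow_sub_one_pos hL (by linarith)
  have hM1 : (1 : ℝ) < 1 + (M : ℝ) := by
    have : (1 : ℝ) ≤ (M : ℝ) := by exact_mod_cast hM
    linarith
  have hsh := B3Op116DKernelRegularCellBox.sheetEndC_nonneg (P := P) hL hr0 hθ hM1 hcK1 hcS
  unfold derCBθ B3Op116DKernelRegularBox.derCB
  have := P.mesh_pos 0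
  positivity

/-- `mixCB(M) ≥ 0` for `M > d`, `M ≥ 2`, `θ > 0` (`0 < δ₁`; `C, C_M, a, s, δ_A ≥ 0`). [cite: Balaban1983Higgs3, (1.16) p.414, (2.10) p.426] -/
theorem mixCB_nonneg (hL : 1 < P.L) {C : ChargeData N} (k nF : ℕ) {a δ₁ Cst CM s δA θ : ℝ} (hδ₁ : 0 < δ₁) (hCst : 0 ≤ Cst)
    (hCM : 0 ≤ CM) (ha : 0 ≤ a) (hs : 0 ≤ s) (hδA : 0 ≤ δA) (hθ : 0 < θ) (M : ℕ) (hM : 2 ≤ M) (hd : P.d < M) :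
    0 ≤ mixCB P N C k nF a δ₁ Cst CM s δA θ M := by
  obtain ⟨hr0, -, -, hcd, hcS⟩ := seqM_pos (P := P) (N := N) (C := C) (k := k) (nF := nF) (a := a) hL hδ₁ hCst hCM ha hs hδA hθ (M - 1)
  have hcKe : 0 ≤ B3Op116MixedKernelRegularBox.cKe P Cst := by
    unfold B3Op116MixedKernelRegularBox.cKe B3Op116MixedKernelRegularBox.cK
    have := P.mesh_pos 0
    positivity
  have hM1 : (1 : ℝ) < (M : ℝ) := by exact_mod_cast (lt_of_lt_of_le one_lt_two hM)
  have hfar := B3Op116MajorantStepBoxFar.faceKfar_nonneg (P := P) hL hr0 hM1 hθ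
    (s := (1 : ℝ))
  have hdM : (P.d : ℝ) < (M : ℝ) := by exact_mod_cast hd
  have hden : 0 < (P.L : ℝ) ^ ((M : ℝ) - (P.d : ℝ)) - 1 := rpow_sub_one_pos hL (by linarith)
  unfold mixCB
  have := P.mesh_pos 0
  positivity

set_option maxHeartbeats 1600000 in
/-- **INEQUALITY (2.5) OF [B3], THE (1.16) ALTERNATIVE, ON A CELL-PRODUCT BOX `□` WITHOUT THE SUPPORT CLAUSE ON `Ã`** — all orders `n, n′ ≥ 1`
with `n + n′ > d`, every Hölder index `0 ≤ α < 1`.  For `d ≥ 1`, `L ≥ 2`, `a > 0`, `m² > 0`, a regularity budget `c ≥ 0`, support size `m`,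
bump constants `c₁, c₂ ≥ 0`: ∃ charge threshold `E₀ > 0`, ∀ charge data with `e² ≤ E₀`, ∃ `K₀min`, ∀ `0 ≤ α < 1`, ∀ `K₀ ≥ K₀min`, ∃ a smallness
threshold `t > 0`, plug dictionaries `0 < δ_V, δ_D, δ_H, δ_M ≤ 1`, `C_V, C_D, C_H, C_M > 0`, `C_MM ≥ 0`, and the `δG` data `δ₀ > 0`, `C_G > 0`,
such that on every torus `T_ε` (dimension `d`, ratio `L`, `K₀ ∣ M`), every scale `1 ≤ k ≤ K` with `≥ 3` cubes per direction and `L^kε ≤ 1`,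
EVERY CELL-PRODUCT BOX `□ = cellBox k K₀ S`, every big-block union `Ω₂ ⊆ □`, all backgrounds `Ã, B̃` with `B̃`, `Ã+B̃` (I.2.23)-regular ON
`□` (`δ_B, δ_{AB} ≥ 0`) and small (`L^kδ_B|e| ≤ t`, `L^kδ_{AB}|e| ≤ t`, `L^kδ_B ≤ c|e|`), `Ã` (I.2.23)-regular (`δ_A ≥ 0`), `sup_b|Ã_b| ≤ s`
(`s ≥ 0`), `(L^kε)|e|s ≤ 1` — AND NO SUPPORT OR DEEP-BOND CLAUSE ON `Ã` —, every margin `r₀` and carrier parameters `0 ≤ e_Rp_R`, `L^kε ≤ e_Rp_R`: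
`(sect2Smooth116 hP1 C □ Ω₂ Ã B̃ …).Ineq25At n n′ α (min δ₀ δ) (C_G + K(c₁,c₂+2c₁,d,m)·(valCB(M) + derCBθ(M)) + (holCBθ(M−1) + 2derCBθ(M) +
d·m·mixCB(M)·#Ix))`, `M = n + n′`, `δ = min(δ_V∕(4L)^M, δ_D∕(4L)^M∕2, δ_H∕(4L)^M, rateM(M−1)∕2)` — i.e. `‖hδG_k(□,Ω₂,B̃)h′‖_{1,α}` AND
`‖h(1.16)^□_{n,n′}h′‖_{1,α} ≤ C·(e_Rp_R)^{n+n′}e^{−min(δ₀,δ)dist(supp h,supp h′)}` for all smooth localization functions of the carrier — the route-γ′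
constants `valCB`, `derCBθ` (`θ = 1`), `holCBθ` (`θ = 1`), `mixCB` (`θ = 1`) each at its own plug dictionary.  p40's `ineq25At_op116_smooth_of_bounds`
on `Ω = □` fed by D, E (through §1 with D's derivative binder), M3 and p33's `δG` clause.
[cite: Balaban1983Higgs3, (2.5) p.424, (1.16) p.414, (1.32) p.420, (2.10)-(2.11) p.426, p.433] [cite: Balaban1982Higgs1, Prop. 2.1 (2.23)-(2.25) p.610, p.611 l.1–2, (3.44) p.619] -/
theorem ineq25At_op116_cellBox (d L : ℕ) (hd : 1 ≤ d) (hL : 2 ≤ L) {a : ℝ} (ha : 0 < a) {msq : ℝ} (hmsq : 0 < msq)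
    {c : ℝ} (hc : 0 ≤ c) (N m : ℕ) {c₁ c₂ : ℝ} (hc₁ : 0 ≤ c₁) (hc₂ : 0 ≤ c₂)
    (n n' : ℕ) (hn : 1 ≤ n) (hn' : 1 ≤ n') (hdn : d < n + n') :
    ∃ E₀ : ℝ, 0 < E₀ ∧ ∀ (C : ChargeData N), C.e ^ 2 ≤ E₀ →
      ∃ K₀min : ℕ, ∀ {α : ℝ}, 0 ≤ α → α < 1 → ∀ K₀ : ℕ, K₀min ≤ K₀ →
      ∃ t δV δD δH δM δ₀ CV CD CH CM CMM CG : ℝ, 0 < t ∧ (0 < δV ∧ δV ≤ 1) ∧ (0 < δD ∧ δD ≤ 1) ∧ (0 < δH ∧ δH ≤ 1) ∧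
        (0 < δM ∧ δM ≤ 1) ∧ 0 < δ₀ ∧ 0 < CV ∧ 0 < CD ∧ 0 < CH ∧ 0 < CM ∧ 0 ≤ CMM ∧ 0 < CG ∧
      ∀ (P : HiggsLattice.Params) (hP1 : 1 < P.L), P.d = d → P.L = L → K₀ ∣ P.M →
      ∀ {k : ℕ}, 1 ≤ k → k ≤ P.K → (∀ μ, 3 * half P k K₀ ≤ P.sitesPerDir 0 μ) → P.mesh k ≤ 1 →
      ∀ (S : Fin P.d → Finset ℕ) (Ω₂ : Finset (HiggsLattice.Site P 0)), IsBigBlockUnion k K₀ Ω₂ → Ω₂ ⊆ cellBox k K₀ S →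
      ∀ (A B : HiggsLattice.VecField P 0) {δB δAB δA s : ℝ}, 0 ≤ δB → 0 ≤ δAB → 0 ≤ δA → 0 ≤ s →
        (∀ z ∈ cellBox k K₀ S, ∀ μ ν : Fin P.d, |B ⟨z.shift ν, μ⟩ - B ⟨z, μ⟩| ≤ δB) →
        (∀ z ∈ cellBox k K₀ S, ∀ μ ν : Fin P.d, |(A + B) ⟨z.shift ν, μ⟩ - (A + B) ⟨z, μ⟩| ≤ δAB) →
        (∀ (z : HiggsLattice.Site P 0) (μ ν : Fin P.d), |A ⟨z.shift ν, μ⟩ - A ⟨z, μ⟩| ≤ δA) →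
        (P.L : ℝ) ^ k * δB * |C.e| ≤ t → (P.L : ℝ) ^ k * δAB * |C.e| ≤ t → (P.L : ℝ) ^ k * δB ≤ c * |C.e| →
        (∀ b : HiggsLattice.PBond P 0, |A b| ≤ s) → P.mesh k * (|C.e| * s) ≤ 1 →
      ∀ (r₀ : ℕ) {eR pR : ℝ}, 0 ≤ eR * pR → P.mesh k ≤ eR * pR → Ix N →
        (sect2Smooth116 hP1 C (cellBox k K₀ S) Ω₂ A B msq a k K₀ r₀ m c₁ c₂ eR pR).Ineq25At n n' α
          (min δ₀ (min (min (δV / (4 * (P.L : ℝ)) ^ (n + n')) (δD / (4 * (P.L : ℝ)) ^ (n + n') / 2))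
            (min (δH / (4 * (P.L : ℝ)) ^ (n + n'))
              (rateM P N C k (faces k K₀ S).card a δM CM CMM s δA 1 (n + n' - 1) / 2))))
          (CG + (smoothConst P.d m c₁ (c₂ + 2 * c₁) *
              (valCB P N C k (faces k K₀ S).card a (P.mesh 0 ^ P.d * CV) (cK1 P C k CV s) s δA δV (n + n')
                + derCBθ P N C k (faces k K₀ S).card a (P.mesh 0 ^ P.d * CD) (cK1 P C k CD s) s δA δD 1 (n + n'))
            + ((holCBθ P N C k (faces k K₀ S).card a (P.mesh 0 ^ P.d * CH) (cK1 P C k CH s) s δA δH α (P.mesh 0 ^ P.d * CH) 1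
                    (n + n' - 1)
                  + 2 * derCBθ P N C k (faces k K₀ S).card a (P.mesh 0 ^ P.d * CD) (cK1 P C k CD s) s δA δD 1 (n + n'))
              + P.d * m * (mixCB P N C k (faces k K₀ S).card a δM CM CMM s δA 1 (n + n') * (Fintype.card (Ix N) : ℝ))))) := by
  -- the five suppliers
  obtain ⟨E₀, hE₀, hG⟩ := ineq25_smooth_regularNested d L hd hL ha hmsq hc N m hc₁ hc₂
  refine ⟨E₀, hE₀, fun C heC => ?_⟩
  obtain ⟨KG, hKG⟩ := hG C heC
  obtain ⟨KV, hKV⟩ := kernel116_value_cellBox_le d L hd hL ha hmsq N C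
  obtain ⟨KD, hKD⟩ := kernel116_deriv_cellBox_interior_le d L hd hL ha hmsq N C
  obtain ⟨KH, hKH⟩ := kernel116_holder_cellBox_interior_le d L hd hL ha hmsq N C
  obtain ⟨KM, hKM⟩ := kernel116_mixed_cellBox_interior_le d L hd hL ha hmsq N C
  refine ⟨max (max (max KV KD) (max KH KM)) (max KG 1), fun {α} hα0 hα1 K₀ hK₀ => ?_⟩
  have hKV' : KV ≤ K₀ := ((le_max_left _ _).trans (le_max_left _ _)).trans ((le_max_left _ _).trans hK₀)
  have hKD' : KD ≤ K₀ := ((le_max_right _ _).trans (le_max_left _ _)).trans ((le_max_left _ _).trans hK₀)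
  have hKH' : KH ≤ K₀ := ((le_max_left _ _).trans (le_max_right _ _)).trans ((le_max_left _ _).trans hK₀)
  have hKM' : KM ≤ K₀ := ((le_max_right _ _).trans (le_max_right _ _)).trans ((le_max_left _ _).trans hK₀)
  have hKG' : KG ≤ K₀ := (le_max_left _ _).trans ((le_max_right _ _).trans hK₀)
  have hK₀1 : 1 ≤ K₀ := (le_max_right _ _).trans ((le_max_right _ _).trans hK₀)
  obtain ⟨tV, δV, CV, htV, hδV, hδV1, hCV, hV⟩ := hKV K₀ hKV'
  obtain ⟨tD, δD, CD, htD, hδD, hδD1, hCD, hD⟩ := hKD K₀ hKD'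
  obtain ⟨tH, δH, CH, htH, hδH, hδH1, hCH, hH⟩ := hKH hα0 hα1 K₀ hKH'
  obtain ⟨tM, δM, CM, CMM, htM, hδM, hδM1, hCM, hCMM, hM⟩ := hKM K₀ hKM'
  obtain ⟨tG, δ₀, CG, htG, hδ₀, hCG, hGG⟩ := hKG hα0 hα1 K₀ hKG'
  -- the common smallness threshold
  set t : ℝ := min (min (min tV tD) (min tH tM)) tG with htdef
  have httV : t ≤ tV := (min_le_left _ _).trans ((min_le_left _ _).trans (min_le_left _ _))
  have httD : t ≤ tD := (min_le_left _ _).trans ((min_le_left _ _).trans (min_le_right _ _))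
  have httH : t ≤ tH := (min_le_left _ _).trans ((min_le_right _ _).trans (min_le_left _ _))
  have httM : t ≤ tM := (min_le_left _ _).trans ((min_le_right _ _).trans (min_le_right _ _))
  have httG : t ≤ tG := min_le_right _ _
  refine ⟨t, δV, δD, δH, δM, δ₀, CV, CD, CH, CM, CMM, CG, lt_min (lt_min (lt_min htV htD) (lt_min htH htM)) htG,
    ⟨hδV, hδV1⟩, ⟨hδD, hδD1⟩, ⟨hδH, hδH1⟩, ⟨hδM, hδM1⟩, hδ₀, hCV, hCD, hCH, hCM, hCMM, hCG, ?_⟩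
  intro P hP1 hPd hPL hK₀M k hk hkK h3h hmesh S Ω₂ hΩ₂ hsub A B δB δAB δA s hδB hδAB hδA hs hregB hregAB hregA htB htAB hcB hA ht1
    r₀ eR pR ht0 ht i₀
  have hL2 : 2 ≤ P.L := by rw [hPL]; exact hL
  have hLr : (1 : ℝ) < (P.L : ℝ) := by exact_mod_cast hP1
  have hdP : P.d < n + n' := by rw [hPd]; exact hdn
  -- the specialized plugs on `□ = cellBox k K₀ S`
  have hVb := hV P hP1 hPd hPL hK₀M hk hkK h3h hmesh S A B hs hδA hδB hδAB hA hregA hregB (htB.trans httV) hregAB (htAB.trans httV) i₀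
  have hDb := hD P hP1 hPd hPL hK₀M hk hkK h3h hmesh S A B hs hδA hδB hδAB hA hregA hregB (htB.trans httD) hregAB (htAB.trans httD) i₀
  have hHb := hH P hP1 hPd hPL hK₀M hk hkK h3h hmesh S A B hs hδA hδB hδAB hA hregA hregB (htB.trans httH) hregAB (htAB.trans httH) i₀
  have hMb := hM P hP1 hPd hPL hK₀M hk hkK h3h hmesh S A B hs hδA hδB hδAB hA hregA hregB (htB.trans httM) hregAB (htAB.trans httM)
    ht1 i₀
  have hδG : (sect2DeltaSmooth hP1 C (cellBox k K₀ S) Ω₂ B msq a k K₀ r₀ m c₁ c₂).Ineq25 α δ₀ CG :=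
    hGG P hP1 hPd hPL hK₀M hk hkK h3h hmesh (cellBox k K₀ S) Ω₂ (isBigBlockUnion_cellBox S) hΩ₂ hsub B hδB hregB (htB.trans httG) hcB r₀
  clear hV hD hH hM hGG hKV hKD hKH hKM hKG hG
  -- orders
  obtain ⟨m₁, rfl⟩ : ∃ m₁, n = m₁ + 1 := ⟨n - 1, by omega⟩
  obtain ⟨m₂, rfl⟩ : ∃ m₂, n' = m₂ + 1 := ⟨n' - 1, by omega⟩
  set M := m₁ + 1 + (m₂ + 1) with hMdef
  have hM1 : M - 1 = m₁ + (m₂ + 1) := by omega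
  have hMsw : m₂ + 1 + (m₁ + 1) = M := by omega
  have hM1sw : m₂ + (m₁ + 1) = M - 1 := by omega
  have hM2 : 2 ≤ M := by omega
  have hMge1 : 1 ≤ M := by omega
  set nF := (faces k K₀ S).card with hnFdef
  -- thresholds
  have hdM : (P.d : ℝ) < (M : ℝ) := by exact_mod_cast hdP
  have hdV : (P.d : ℝ) < ((m₁ + 1 + (m₂ + 1) : ℕ) : ℝ) + 2 := by linarith
  have hdV' : (P.d : ℝ) < ((m₂ + 1 + (m₁ + 1) : ℕ) : ℝ) + 2 := by rw [hMsw]; linarith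
  have hdD : (P.d : ℝ) < ((m₁ + 1 + (m₂ + 1) : ℕ) : ℝ) + 1 := by linarith
  have hdD' : (P.d : ℝ) < ((m₂ + 1 + (m₁ + 1) : ℕ) : ℝ) + 1 := by rw [hMsw]; linarith
  have hdH : (P.d : ℝ) < 1 + ((m₁ + 1 + (m₂ + 1) : ℕ) : ℝ) - α := by linarith
  have hdH' : (P.d : ℝ) < 1 + ((m₂ + 1 + (m₁ + 1) : ℕ) : ℝ) - α := by rw [hMsw]; linarith
  have hd' : P.d < m₂ + 1 + (m₁ + 1) := by omega
  have hdCH : (P.d : ℝ) < 1 + ((M - 1 + 1 : ℕ) : ℝ) - α := by rw [show M - 1 + 1 = M by omega]; linarith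
  -- the displayed constants and their signs
  set cV : ℝ := valCB P N C k nF a (P.mesh 0 ^ P.d * CV) (cK1 P C k CV s) s δA δV M with hcVdef
  set cD : ℝ := derCBθ P N C k nF a (P.mesh 0 ^ P.d * CD) (cK1 P C k CD s) s δA δD 1 M with hcDdef
  set cH : ℝ := holCBθ P N C k nF a (P.mesh 0 ^ P.d * CH) (cK1 P C k CH s) s δA δH α (P.mesh 0 ^ P.d * CH) 1 (M - 1) with hcHdef
  set cM : ℝ := mixCB P N C k nF a δM CM CMM s δA 1 M * (Fintype.card (Ix N) : ℝ) with hcMdef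
  have hcV0 : 0 ≤ cV := valCB_nonneg hP1 k nF hδV hCV.le hs hδA M (by linarith)
  have hcD0 : 0 ≤ cD := derCBθ_nonneg hP1 k nF hδD hCD.le hs hδA one_pos M hMge1 (by linarith)
  have hcH0 : 0 ≤ cH := by
    have hc : 0 ≤ P.mesh 0 ^ P.d * CH := mul_nonneg (pow_nonneg (P.mesh_pos 0).le _) hCH.le
    exact B3Op116HolderKernelRegularBox.holCBθ_nonneg hP1 k nF hδH hδH1 hc
      (B3Op116DKernelRegularTorus.cK1_ge (P := P) (C := C) (k := k) hCH.le hs).2 hs hδA hα1 hc one_pos (M - 1) hdCH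
  have hcM0 : 0 ≤ cM :=
    mul_nonneg (mixCB_nonneg hP1 k nF hδM hCM.le hCMM ha.le hs hδA one_pos M hM2 hdP) (Nat.cast_nonneg _)
  have hcHD0 : 0 ≤ cH + 2 * cD := by positivity
  -- the common rate
  set rV : ℝ := δV / (4 * (P.L : ℝ)) ^ M with hrVdef
  set rD : ℝ := δD / (4 * (P.L : ℝ)) ^ M / 2 with hrDdef
  set rH : ℝ := δH / (4 * (P.L : ℝ)) ^ M with hrHdef
  set rM : ℝ := rateM P N C k nF a δM CM CMM s δA 1 (M - 1) / 2 with hrMdef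
  set δ : ℝ := min (min rV rD) (min rH rM) with hδdef
  have h4L0 : (0 : ℝ) < 4 * (P.L : ℝ) := by have := P.hL; positivity
  have hrV0 : 0 < rV := div_pos hδV (pow_pos h4L0 _)
  have hrD0 : 0 < rD := by have := div_pos hδD (pow_pos h4L0 M); positivity
  have hrH0 : 0 < rH := div_pos hδH (pow_pos h4L0 _)
  have hrM0 : 0 < rM := by
    obtain ⟨h, -, -, -, -⟩ := seqM_pos (P := P) (N := N) (C := C) (k := k) (nF := nF) (a := a) hP1 hδM hCM.le hCMM ha.le hs hδA
      one_pos (M - 1)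
    rw [hrMdef]; exact half_pos h
  have hδ0 : 0 ≤ δ := (lt_min (lt_min hrV0 hrD0) (lt_min hrH0 hrM0)).le
  have hδrV : δ ≤ rV := (min_le_left _ _).trans (min_le_left _ _)
  have hδrD : δ ≤ rD := (min_le_left _ _).trans (min_le_right _ _)
  have hδrH : δ ≤ rH := (min_le_right _ _).trans (min_le_left _ _)
  have hδrM : δ ≤ rM := (min_le_right _ _).trans (min_le_right _ _)
  -- the displayed rates ARE these
  have eV : rateB P N C k nF a (P.mesh 0 ^ P.d * CV) (cK1 P C k CV s) s δA δV (P.mesh 0 ^ P.d * CV) (cK1 P C k CV s) M = rV :=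
    rateB_closed M
  have eD : rateB P N C k nF a (P.mesh 0 ^ P.d * CD) (cK1 P C k CD s) s δA δD (P.mesh 0 ^ P.d * CD) (cK1 P C k CD s) M / 2 = rD := by
    rw [rateB_closed M]
  have eH : rateB P N C k nF a (P.mesh 0 ^ P.d * CH) (cK1 P C k CH s) s δA δH (P.mesh 0 ^ P.d * CH) (cK1 P C k CH s) M = rH :=
    rateB_closed M
  -- scale factors and geometry
  have hmk : 0 ≤ P.mesh k := (P.mesh_pos k).le
  have hpowM : P.mesh k ^ M ≤ (eR * pR) ^ M := pow_le_pow_left₀ hmk ht M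
  have heM : 0 ≤ P.mesh k ^ M := pow_nonneg hmk M
  have hG2 : 0 ≤ P.mesh k ^ 2 * (P.mesh k ^ P.d)⁻¹ := by positivity
  have hG1 : 0 ≤ P.mesh k * (P.mesh k ^ P.d)⁻¹ := by positivity
  have hG0 : 0 ≤ (P.mesh k ^ P.d)⁻¹ := by positivity
  have hGH : 0 ≤ P.mesh k * (P.mesh k ^ P.d)⁻¹ * (P.mesh k ^ α)⁻¹ := by
    have := Real.rpow_nonneg hmk α; positivity
  have hLk : (0 : ℝ) < (P.L : ℝ) ^ k := by positivity
  have htd : ∀ x x' : HiggsLattice.Site P 0, (0 : ℝ) ≤ (HiggsLattice.Site.tdist x x' : ℝ) / (P.L : ℝ) ^ k :=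
    fun x x' => div_nonneg (Nat.cast_nonneg _) hLk.le
  have htdH : ∀ x₁ x₂ x' : HiggsLattice.Site P 0,
      (0 : ℝ) ≤ min (HiggsLattice.Site.tdist x₁ x' : ℝ) (HiggsLattice.Site.tdist x₂ x' : ℝ) / (P.L : ℝ) ^ k :=
    fun x₁ x₂ x' => div_nonneg (le_min (Nat.cast_nonneg _) (Nat.cast_nonneg _)) hLk.le
  have hq : ∀ x₁ x₂ : HiggsLattice.Site P 0, (0 : ℝ) ≤ (P.mesh 0 * (HiggsLattice.Site.tdist x₁ x₂ : ℝ)) ^ α :=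
    fun x₁ x₂ => Real.rpow_nonneg (mul_nonneg (P.mesh_pos 0).le (Nat.cast_nonneg _)) α
  have htM0 : 0 ≤ (eR * pR) ^ M := pow_nonneg ht0 M
  -- the derivative binder at the common currency (used twice: as hDv∕hDv′ and inside §1)
  have hDv : ∀ (p q : ℕ), p + q = M → (P.d : ℝ) < ((p + q : ℕ) : ℝ) + 1 →
      ∀ (μ : Fin P.d) (x x' : HiggsLattice.Site P 0),
      Interior k K₀ (cellBox k K₀ S) x → Interior k K₀ (cellBox k K₀ S) x' →
      (P.mesh 0 ^ P.d)⁻¹ * ∑ i' : Ix N, ‖covDeriv C B (op116 C (cellBox k K₀ S) A B msq a k p q (cb P N 0 (x', i'))) ⟨x, μ⟩‖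
        ≤ cD * (eR * pR) ^ M * (P.mesh k * (P.mesh k ^ P.d)⁻¹) *
          Real.exp (-(δ * ((HiggsLattice.Site.tdist x x' : ℝ) / (P.L : ℝ) ^ k))) := by
    intro p q hpq hdpq μ x x' hx hx'
    have h := hDb p q hdpq x' hx'.mem μ x hx
    rw [hpq, eD] at h
    exact h.trans (entry_mono hcD0 heM hpowM hG1 hδrD (htd x x'))
  refine ineq25At_op116_smooth_of_bounds hL2 hk hkK hsub (m₁ + 1) (m₂ + 1) hα0 hα1.le hc₁ hc₂ ht0 hCG.le hδ0 hcV0 hcD0 hcHD0 hcM0 hδG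
    ?_ ?_ ?_ ?_ ?_ ?_ ?_ ?_
  · -- hV ← D value (n, n′)
    intro x x' hx hx'
    have h := hVb (m₁ + 1) (m₂ + 1) hdV x' hx'.mem x
    rw [← hMdef, eV] at h
    exact h.trans (entry_mono hcV0 heM hpowM hG2 hδrV (htd x x'))
  · -- hV′ ← D value (n′, n)
    intro x x' hx hx'
    have h := hVb (m₂ + 1) (m₁ + 1) hdV' x' hx'.mem x
    rw [hMsw, eV] at h
    exact h.trans (entry_mono hcV0 heM hpowM hG2 hδrV (htd x x'))
  · -- hDv ← D derivative (n, n′)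
    exact hDv (m₁ + 1) (m₂ + 1) rfl hdD
  · -- hDv′ ← D derivative (n′, n)
    exact hDv (m₂ + 1) (m₁ + 1) hMsw hdD'
  · -- hH ← §1 on E (n − 1 + 1, n′) and D's derivative binder
    intro μ x₁ x₂ x' Γ hx₁ hx₂ hx' hne hΓ
    refine holder_binder_of_inside C B hK₀1 (op116 C (cellBox k K₀ S) A B msq a k (m₁ + 1) (m₂ + 1)) (mul_nonneg hcD0 htM0)
      (mul_nonneg hcH0 htM0) hδ0 hα0 (hDv (m₁ + 1) (m₂ + 1) rfl hdD) ?_ μ x₁ x₂ x' Γ hx₁ hx₂ hx' hne hΓ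
    intro μ x₁ x₂ x' Γ hx₁ hx₂ hx' hne hΓ hΓΩ
    have h := hHb m₁ (m₂ + 1) hdH x' hx'.mem μ x₁ x₂ hne.symm hx₁ hx₂ Γ hΓ hΓΩ
    rw [← hMdef, eH, ← hM1] at h
    exact h.trans (entry_mono_holder (hq x₁ x₂) hcH0 heM hpowM hGH hδrH (htdH x₁ x₂ x'))
  · -- hH′ ← §1 on E (n′ − 1 + 1, n) and D's derivative binder
    intro μ x₁ x₂ x' Γ hx₁ hx₂ hx' hne hΓ
    refine holder_binder_of_inside C B hK₀1 (op116 C (cellBox k K₀ S) A B msq a k (m₂ + 1) (m₁ + 1)) (mul_nonneg hcD0 htM0)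
      (mul_nonneg hcH0 htM0) hδ0 hα0 (hDv (m₂ + 1) (m₁ + 1) hMsw hdD') ?_ μ x₁ x₂ x' Γ hx₁ hx₂ hx' hne hΓ
    intro μ x₁ x₂ x' Γ hx₁ hx₂ hx' hne hΓ hΓΩ
    have h := hHb m₂ (m₁ + 1) hdH' x' hx'.mem μ x₁ x₂ hne.symm hx₁ hx₂ Γ hΓ hΓΩ
    rw [hMsw, eH, hM1sw] at h
    exact h.trans (entry_mono_holder (hq x₁ x₂) hcH0 heM hpowM hGH hδrH (htdH x₁ x₂ x'))
  · -- hM ← M3 (n, n′)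
    intro μ ν x x' hx hx'
    have h := hMb (m₁ + 1) (m₂ + 1) hdP μ ν x x' hx hx'
    rw [← hMdef] at h
    exact h.trans (entry_mono hcM0 heM hpowM hG0 hδrM (htd x x'))
  · -- hM′ ← M3 (n′, n)
    intro μ ν x x' hx hx'
    have h := hMb (m₂ + 1) (m₁ + 1) hd' μ ν x x' hx hx'
    rw [hMsw] at h
    exact h.trans (entry_mono hcM0 heM hpowM hG0 hδrM (htd x x'))

end CellBox

/-! ## §3 The same with a constant and a rate taking NO lattice argument (route γ′'s currency C2∕C3) -/

section Uniform

open B3Op116KernelCurrencyBox (valCBU derCBθU holCBθU valCB_currency derCBθ_currency holCBθ_currency)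
open B3Op116MixedCurrency (mixCBU seqMU₁ mixCB_currency seqMU_rate)

/-- **the uniform constant of the assembled box member**: `C_G + K(c₁,c₂+2c₁,d,m)·(valCBU(M) + derCBθU(M)) + (holCBθU(M−1) + 2derCBθU(M) +
d·m·mixCBU(M)·#Ix)`, `M = n + n′` — a function of the fixed data `d, L, N, m, c₁, c₂, a, α`, the ∃-constants of `ineq25At_op116_cellBox`, the
number of faces `n_F` of `□`, and print's smallness parameters `σ = |e|s`, `τ` (`≥ L^k|e|δ_A`); NO `ε`, NO `k` (p35 g29's `valCBU` ∕ `derCBθU` ∕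
`holCBθU` ∕ `mixCBU`). [cite: Balaban1983Higgs3, (2.5) p.424, Prop. 1 pp.420–421, p.433] -/
def unifCB (d : ℕ) (L : ℝ) (N nF m : ℕ) (c₁ c₂ CV CD CH CM CMM CG δV δD δH δM a α σ τ : ℝ) (n n' : ℕ) : ℝ :=
  CG + (smoothConst d m c₁ (c₂ + 2 * c₁) * (valCBU d L N nF CV δV a σ τ (n + n') + derCBθU d L N nF CD δD a σ τ 1 (n + n'))
    + ((holCBθU d L N nF CH CH δH a α σ τ 1 (n + n' - 1) + 2 * derCBθU d L N nF CD δD a σ τ 1 (n + n'))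
      + (d : ℝ) * m * (mixCBU d L N nF CM CMM δM a σ τ 1 (n + n') * (Fintype.card (Ix N) : ℝ))))

/-- **the uniform rate of the assembled box member**: `min(δ_V∕(4L)^M, δ_D∕(4L)^M∕2, δ_H∕(4L)^M, (seqMU₁ … (M−1)).1∕2)` — the displayed rate of
`ineq25At_op116_cellBox` with the mixed rate in p35 g29's lattice-free form (`seqMU_rate`); NO `ε`, NO `k`.
[cite: Balaban1983Higgs3, (2.5) p.424, (2.10) p.426, Prop. 1 pp.420–421] -/
def unifRB (d : ℕ) (L : ℝ) (N nF : ℕ) (CM CMM δV δD δH δM a σ τ : ℝ) (n n' : ℕ) : ℝ :=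
  min (min (δV / (4 * L) ^ (n + n')) (δD / (4 * L) ^ (n + n') / 2))
    (min (δH / (4 * L) ^ (n + n')) ((seqMU₁ d L N nF CM CMM δM a σ τ 1 (n + n' - 1)).1 / 2))

set_option maxHeartbeats 1600000 in
/-- **INEQUALITY (2.5) OF [B3], THE (1.16) ALTERNATIVE, ON A CELL-PRODUCT BOX WITHOUT THE SUPPORT CLAUSE, WITH A CONSTANT AND A RATE INDEPENDENT OF
`ε` AND `k`** (Prop. 1 pp. 420–421: *"The constant O(1) … is independent of ε, k, the domains Ω, Ω₁, Ω₂, the vector field B̃"*): `ineq25At_op116_cellBox`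
with the additional regime hypothesis `L^k·δ_A·|e| ≤ t` on `Ã` (print's own smallness of `Ã`, p. 412) and the conclusion
`(sect2Smooth116 hP1 C □ Ω₂ Ã B̃ …).Ineq25At n n′ α (min δ₀ (unifRB d L N n_F C_M C_MM δ_V δ_D δ_H δ_M a (|e|s) t n n′))
(unifCB d L N n_F m c₁ c₂ C_V C_D C_H C_M C_MM C_G δ_V δ_D δ_H δ_M a α (|e|s) t n n′)`, `n_F = #faces(□)` — NO lattice argument besides the face count of
`□` and print's `σ = |e|s`.  From §2 by p35 g29's currency lemmas `valCB_currency` ∕ `derCBθ_currency` ∕ `holCBθ_currency` (C2) ∕ `mixCB_currency`,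
`seqMU_rate` (C3) and p40's `ineq25At_smooth116_mono`.
[cite: Balaban1983Higgs3, (2.5) p.424, (1.16) p.414, Prop. 1 pp.420–421, p.412, p.433] [cite: Balaban1982Higgs1, Prop. 2.1 p.610, p.611 l.1–2] -/
theorem ineq25At_op116_cellBox_uniform (d L : ℕ) (hd : 1 ≤ d) (hL : 2 ≤ L) {a : ℝ} (ha : 0 < a) {msq : ℝ} (hmsq : 0 < msq)
    {c : ℝ} (hc : 0 ≤ c) (N m : ℕ) {c₁ c₂ : ℝ} (hc₁ : 0 ≤ c₁) (hc₂ : 0 ≤ c₂)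
    (n n' : ℕ) (hn : 1 ≤ n) (hn' : 1 ≤ n') (hdn : d < n + n') :
    ∃ E₀ : ℝ, 0 < E₀ ∧ ∀ (C : ChargeData N), C.e ^ 2 ≤ E₀ →
      ∃ K₀min : ℕ, ∀ {α : ℝ}, 0 ≤ α → α < 1 → ∀ K₀ : ℕ, K₀min ≤ K₀ →
      ∃ t δV δD δH δM δ₀ CV CD CH CM CMM CG : ℝ, 0 < t ∧ (0 < δV ∧ δV ≤ 1) ∧ (0 < δD ∧ δD ≤ 1) ∧ (0 < δH ∧ δH ≤ 1) ∧
        (0 < δM ∧ δM ≤ 1) ∧ 0 < δ₀ ∧ 0 < CV ∧ 0 < CD ∧ 0 < CH ∧ 0 < CM ∧ 0 ≤ CMM ∧ 0 < CG ∧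
      ∀ (P : HiggsLattice.Params) (hP1 : 1 < P.L), P.d = d → P.L = L → K₀ ∣ P.M →
      ∀ {k : ℕ}, 1 ≤ k → k ≤ P.K → (∀ μ, 3 * half P k K₀ ≤ P.sitesPerDir 0 μ) → P.mesh k ≤ 1 →
      ∀ (S : Fin P.d → Finset ℕ) (Ω₂ : Finset (HiggsLattice.Site P 0)), IsBigBlockUnion k K₀ Ω₂ → Ω₂ ⊆ cellBox k K₀ S →
      ∀ (A B : HiggsLattice.VecField P 0) {δB δAB δA s : ℝ}, 0 ≤ δB → 0 ≤ δAB → 0 ≤ δA → 0 ≤ s →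
        (∀ z ∈ cellBox k K₀ S, ∀ μ ν : Fin P.d, |B ⟨z.shift ν, μ⟩ - B ⟨z, μ⟩| ≤ δB) →
        (∀ z ∈ cellBox k K₀ S, ∀ μ ν : Fin P.d, |(A + B) ⟨z.shift ν, μ⟩ - (A + B) ⟨z, μ⟩| ≤ δAB) →
        (∀ (z : HiggsLattice.Site P 0) (μ ν : Fin P.d), |A ⟨z.shift ν, μ⟩ - A ⟨z, μ⟩| ≤ δA) →
        (P.L : ℝ) ^ k * δB * |C.e| ≤ t → (P.L : ℝ) ^ k * δAB * |C.e| ≤ t → (P.L : ℝ) ^ k * δA * |C.e| ≤ t →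
        (P.L : ℝ) ^ k * δB ≤ c * |C.e| →
        (∀ b : HiggsLattice.PBond P 0, |A b| ≤ s) → P.mesh k * (|C.e| * s) ≤ 1 →
      ∀ (r₀ : ℕ) {eR pR : ℝ}, 0 ≤ eR * pR → P.mesh k ≤ eR * pR → Ix N →
        (sect2Smooth116 hP1 C (cellBox k K₀ S) Ω₂ A B msq a k K₀ r₀ m c₁ c₂ eR pR).Ineq25At n n' α
          (min δ₀ (unifRB d (L : ℝ) N (faces k K₀ S).card CM CMM δV δD δH δM a (|C.e| * s) t n n'))
          (unifCB d (L : ℝ) N (faces k K₀ S).card m c₁ c₂ CV CD CH CM CMM CG δV δD δH δM a α (|C.e| * s) t n n') := by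
  obtain ⟨E₀, hE₀, hR⟩ := ineq25At_op116_cellBox d L hd hL ha hmsq hc N m hc₁ hc₂ n n' hn hn' hdn
  refine ⟨E₀, hE₀, fun C heC => ?_⟩
  obtain ⟨K₀min, hK⟩ := hR C heC
  refine ⟨K₀min, fun {α} hα0 hα1 K₀ hK₀ => ?_⟩
  obtain ⟨t, δV, δD, δH, δM, δ₀, CV, CD, CH, CM, CMM, CG, ht, hδV, hδD, hδH, hδM, hδ₀, hCV, hCD, hCH, hCM, hCMM, hCG, h⟩ :=
    hK hα0 hα1 K₀ hK₀
  refine ⟨t, δV, δD, δH, δM, δ₀, CV, CD, CH, CM, CMM, CG, ht, hδV, hδD, hδH, hδM, hδ₀, hCV, hCD, hCH, hCM, hCMM, hCG, ?_⟩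
  intro P hP1 hPd hPL hK₀M k hk hkK h3h hmesh S Ω₂ hΩ₂ hsub A B δB δAB δA s hδB hδAB hδA hs hregB hregAB hregA htB htAB htA hcB hA ht1
    r₀ eR pR ht0 htm i₀
  -- §2's member with its displayed constant
  have hmain := h P hP1 hPd hPL hK₀M hk hkK h3h hmesh S Ω₂ hΩ₂ hsub A B hδB hδAB hδA hs hregB hregAB hregA htB htAB hcB hA ht1 r₀ ht0 htm i₀
  have hε := P.mesh_pos 0
  have hdP : P.d < n + n' := by rw [hPd]; exact hdn
  have hM : (P.d : ℝ) < ((n + n' : ℕ) : ℝ) := by exact_mod_cast hdP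
  have hM2 : 2 ≤ n + n' := by omega
  have hτ : (P.L : ℝ) ^ k * (|C.e| * δA) ≤ t := by
    calc (P.L : ℝ) ^ k * (|C.e| * δA) = (P.L : ℝ) ^ k * δA * |C.e| := by ring
      _ ≤ t := htA
  set nF := (faces k K₀ S).card with hnF
  -- the four currency bounds (C2, C3) at τ = t
  have hv := valCB_currency (N := N) (C := C) (nF := nF) hP1 hk hmesh ha hδV.1 hCV.le hs hδA hτ (n + n') (by linarith)
  have hdd := derCBθ_currency (N := N) (C := C) (nF := nF) hP1 hk hmesh ha hδD.1 hCD.le hs hδA hτ one_pos (n + n') (by linarith)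
  have hdH : (P.d : ℝ) < 1 + ((n + n' - 1 + 1 : ℕ) : ℝ) - α := by rw [show n + n' - 1 + 1 = n + n' by omega]; linarith
  have hh := holCBθ_currency (N := N) (C := C) (nF := nF) hP1 hk hmesh ha hδH.1 hCH.le hs hδA hτ hα1 hCH.le one_pos (n + n' - 1) hdH
  have hm := mixCB_currency (N := N) (C := C) (nF := nF) hP1 hk hmesh ha hδM.1 hCM.le hCMM hs hδA one_pos hτ hdP
  -- the sign of §2's constant
  have hcV0 := valCB_nonneg (N := N) (C := C) (a := a) hP1 k nF hδV.1 hCV.le hs hδA (n + n') (by linarith)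
  have hcD0 := derCBθ_nonneg (N := N) (C := C) (a := a) hP1 k nF hδD.1 hCD.le hs hδA one_pos (n + n') (by omega) (by linarith)
  have hcH : 0 ≤ P.mesh 0 ^ P.d * CH := mul_nonneg (pow_nonneg hε.le P.d) hCH.le
  have hcH0 := B3Op116HolderKernelRegularBox.holCBθ_nonneg (N := N) (C := C) (a := a) hP1 k nF hδH.1 hδH.2 hcH
    (B3Op116DKernelRegularTorus.cK1_ge (P := P) (C := C) (k := k) hCH.le hs).2 hs hδA hα1 hcH one_pos (n + n' - 1) hdH
  have hcM0 := mixCB_nonneg (N := N) (C := C) hP1 k nF hδM.1 hCM.le hCMM ha.le hs hδA one_pos (n + n') hM2 hdP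
  have hKs := B3Ineq31SmoothLocalization.smoothConst_pos P.d m hc₁ (by positivity : 0 ≤ c₂ + 2 * c₁)
  have hcard : (0 : ℝ) ≤ (Fintype.card (Ix N) : ℝ) := Nat.cast_nonneg _
  have hC0 : 0 ≤ CG + (smoothConst P.d m c₁ (c₂ + 2 * c₁) *
        (valCB P N C k nF a (P.mesh 0 ^ P.d * CV) (cK1 P C k CV s) s δA δV (n + n')
          + derCBθ P N C k nF a (P.mesh 0 ^ P.d * CD) (cK1 P C k CD s) s δA δD 1 (n + n'))
      + ((holCBθ P N C k nF a (P.mesh 0 ^ P.d * CH) (cK1 P C k CH s) s δA δH α (P.mesh 0 ^ P.d * CH) 1 (n + n' - 1)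
            + 2 * derCBθ P N C k nF a (P.mesh 0 ^ P.d * CD) (cK1 P C k CD s) s δA δD 1 (n + n'))
        + P.d * m * (mixCB P N C k nF a δM CM CMM s δA 1 (n + n') * (Fintype.card (Ix N) : ℝ)))) := by
    have := mul_nonneg hcM0 hcard
    positivity
  -- the comparison of the two constants and of the two rates
  have hdm : (0 : ℝ) ≤ (P.d : ℝ) * m := by positivity
  have hle : CG + (smoothConst P.d m c₁ (c₂ + 2 * c₁) *
        (valCB P N C k nF a (P.mesh 0 ^ P.d * CV) (cK1 P C k CV s) s δA δV (n + n')
          + derCBθ P N C k nF a (P.mesh 0 ^ P.d * CD) (cK1 P C k CD s) s δA δD 1 (n + n'))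
      + ((holCBθ P N C k nF a (P.mesh 0 ^ P.d * CH) (cK1 P C k CH s) s δA δH α (P.mesh 0 ^ P.d * CH) 1 (n + n' - 1)
            + 2 * derCBθ P N C k nF a (P.mesh 0 ^ P.d * CD) (cK1 P C k CD s) s δA δD 1 (n + n'))
        + P.d * m * (mixCB P N C k nF a δM CM CMM s δA 1 (n + n') * (Fintype.card (Ix N) : ℝ))))
      ≤ unifCB d (L : ℝ) N nF m c₁ c₂ CV CD CH CM CMM CG δV δD δH δM a α (|C.e| * s) t n n' := by
    subst hPd; subst hPL
    unfold unifCB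
    exact add_le_add le_rfl (add_le_add (mul_le_mul_of_nonneg_left (add_le_add hv hdd) hKs.le)
      (add_le_add (add_le_add hh (by linarith)) (mul_le_mul_of_nonneg_left (mul_le_mul_of_nonneg_right hm hcard) hdm)))
  have hrate : min δ₀ (unifRB d (L : ℝ) N nF CM CMM δV δD δH δM a (|C.e| * s) t n n')
      ≤ min δ₀ (min (min (δV / (4 * (P.L : ℝ)) ^ (n + n')) (δD / (4 * (P.L : ℝ)) ^ (n + n') / 2))
          (min (δH / (4 * (P.L : ℝ)) ^ (n + n')) (rateM P N C k nF a δM CM CMM s δA 1 (n + n' - 1) / 2))) := by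
    subst hPd; subst hPL
    unfold unifRB
    rw [seqMU_rate (k := k) (δA := δA)]
  exact ineq25At_smooth116_mono hrate hle hC0 ht0 hmain

end Uniform

end Literature.MathematicalPhysics.QuantumFieldTheory.Balaban1983to89.B3Ineq25Op116CellBox

end
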